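import Mathlib
import HarnessLib

/-!
# ω-bound for the near-residue-free certificate of crux stmt-ABC-14354, line SketchIdeator1

The elementary bound `ω(n) ≤ P₀ + log n / log P₀` (`P₀ ≥ 2`, `n ≥ 1`) on the number of distinct
prime factors of `n`, which makes the slack of the three-triple certificate `o(log r)`.
-/

-- `Summit.<Summit>.<Problem>` is the mandated summit-side namespace (CONVENTIONS §2); for the
-- single-conjunct summit `ABC` the two coincide, so the duplicate `ABC.ABC` is deliberate.
set_option linter.dupNamespace false

namespace Summit.ABC.ABC.Theorems.TameLocalReceptacle

/-- ω-bound (elementary): the number of distinct prime factors of `n ≥ 1` is at most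
`P₀ + log n / log P₀` for every `P₀ ≥ 2` (the prime factors below `P₀` are fewer than `P₀`; the `m`
prime factors `≥ P₀` have product `≥ P₀ ^ m`, and that product divides `n`). [folklore] -/
theorem stub_card_primeFactors_le (P₀ n : ℕ) (hP : 2 ≤ P₀) (hn : 0 < n) :
    (n.primeFactors.card : ℝ) ≤ (P₀ : ℝ) + Real.log n / Real.log P₀ := by
  set S₁ : Finset ℕ := n.primeFactors.filter (· < P₀)
  set S₂ : Finset ℕ := n.primeFactors.filter (fun p => ¬ p < P₀)
  have hcard : S₁.card + S₂.card = n.primeFactors.card :=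
    Finset.card_filter_add_card_filter_not _
  -- the small prime factors: at most `P₀` of them
  have h1 : S₁.card ≤ P₀ := by
    calc S₁.card ≤ (Finset.range P₀).card :=
          Finset.card_le_card fun p hp => Finset.mem_range.2 (Finset.mem_filter.1 hp).2
      _ = P₀ := Finset.card_range P₀
  -- the large prime factors: `P₀ ^ #S₂ ≤ ∏ S₂ ∣ ∏ primeFactors ∣ n`
  have h2 : P₀ ^ S₂.card ≤ n := by
    have hpow : P₀ ^ S₂.card ≤ ∏ p ∈ S₂, p :=
      Finset.pow_card_le_prod S₂ (fun p => p) P₀ fun p hp => not_lt.1 (Finset.mem_filter.1 hp).2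
    have hdvd : ∏ p ∈ S₂, p ∣ n :=
      (Finset.prod_dvd_prod_of_subset _ _ _ (Finset.filter_subset _ _)).trans
        (Nat.prod_primeFactors_dvd n)
    exact hpow.trans (Nat.le_of_dvd hn hdvd)
  have hP₀ : (1 : ℝ) < P₀ := by exact_mod_cast hP
  have hlogP : 0 < Real.log P₀ := Real.log_pos hP₀
  -- take logarithms: `#S₂ * log P₀ ≤ log n`
  have h3 : (S₂.card : ℝ) ≤ Real.log n / Real.log P₀ := by
    rw [le_div_iff₀ hlogP, ← Real.log_pow]
    have h2' : ((P₀ : ℝ)) ^ S₂.card ≤ n := by exact_mod_cast h2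
    exact Real.log_le_log (by positivity) h2'
  have h1' : (S₁.card : ℝ) ≤ P₀ := by exact_mod_cast h1
  calc (n.primeFactors.card : ℝ) = (S₁.card : ℝ) + S₂.card := by rw [← hcard]; push_cast; ring
    _ ≤ P₀ + Real.log n / Real.log P₀ := add_le_add h1' h3

end Summit.ABC.ABC.Theorems.TameLocalReceptacle
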